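import Summits.Ventures.PercRepro.GenQLargeEightAll
import Summits.Ventures.PercRepro.GenQTraceEightAll
import Summits.Ventures.PercRepro.GenQNineSevenAssembly
import Summits.Ventures.PercRepro.GenQNineSevenResidue
import Summits.Ventures.PercRepro.GenQTraceSevenAll

/-!
# PercRepro — THE `(10, 8)` ROW REDUCED TO ITS TWO FINITE RESIDUES (night-4, gen 18)

With the `(9, 7)` row in the tree (`GenQNineSevenAssembly`: `HighLayersSevenResidue` and `TraceSixResidue` hold, hence
`HighLayersCoreFree 7` and `TraceSumsCore 6`), the `(8, 6)` row (`TraceSumsCore 4, 5`, `HighLayersCoreFree 5, 6`) and the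
reduction `rls_succ_succ_of_highLayers 8`, the `(10, 8)` row of C-025 needs exactly `HighLayersCoreFree 8` and
`TraceSumsCore 7`.  THEOREM LARGE₈ (`jq_nonneg_of_large_eight`: `|G| ≥ eightLargeBound t = 54 / 56 / 60 / 71 / 91` at
`t = 3 … 7`), the size chain (`card_le_fCore_of_core`: a rank-`8` flat of the core has `≤ 175` points) and the
small-corank lemma (`Jq_nonneg_of_card_le`: `d ≤ t − 1`) leave of the former exactly the CERTIFICATE RESIDUE
`HighLayersEightResidue` — the type-`t` balance on the coloop-free rank-`8` flats of rank-`10` Core matroids at the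
coranks `t ≤ d < eightLargeBound t − 8` (`t = 3 … 7`: `3 … 45`, `4 … 47`, `5 … 51`, `6 … 62`, `7 … 82`: `267` cases);
TRACE LARGE₈ (`GenQTraceEightAll`) leaves of the latter `TraceSevenResidue` (`217` cases).

* `highLayersCoreFree_eight_of_residue : HighLayersEightResidue → HighLayersCoreFree 8`;
* `highLayersCoreFree_seven : HighLayersCoreFree 7` and `traceSumsCore_six : TraceSumsCore 6` — the `(9, 7)` row's two
  inputs to the chain, as named theorems;
* **`rls_ten_eight_of_residues : HighLayersEightResidue → TraceSumsCore 7 → ∀ M, RLS M 10 8`** and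
  **`rls_ten_eight_of_finite_residues : HighLayersEightResidue → TraceSevenResidue → ∀ M, RLS M 10 8`** — the precise
  remaining gap of the diagonal at `(10, 8)`, as two finite named statements (`267 + 217` certificate cases).

Imports `GenQLargeEightAll`, `GenQTraceEightAll`, `GenQNineSevenAssembly`, `GenQNineSevenResidue`, `GenQTraceSevenAll`.
-/
namespace PercRepro.Night4

open Finset ThmH SixFour GenQ PerFlat Star NightThree ThmN

/-- **`HighLayersCoreFree 7` is a tree theorem** (the `(9, 7)` row's type residue, `GenQNineSevenAssembly`). -/
theorem highLayersCoreFree_seven : HighLayersCoreFree 7 :=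
  highLayersCoreFree_seven_of_residue highLayersSevenResidue_holds

/-- **`TraceSumsCore 6` is a tree theorem** (the `(9, 7)` row's trace residue, `GenQNineSevenAssembly`). -/
theorem traceSumsCore_six : TraceSumsCore 6 :=
  traceSumsCore_six_of_residue traceSixResidue_holds

/-- **The certificate residue of `HighLayersCoreFree 8`**: the type-`t` balance (`3 ≤ t ≤ 7`) on the coloop-free
rank-`8` flats `G` of rank-`10` Core matroids with `8 + t ≤ |G| < eightLargeBound t` (coranks `t … 45 / 47 / 51 / 62 /
82` at `t = 3 … 7`) — exactly what THEOREM LARGE₈ and the small-corank lemma do not cover. -/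
def HighLayersEightResidue : Prop :=
  ∀ {β : Type} [DecidableEq β] (M : Matroid β) [M.Finite] (G : Finset β), Core M 10 → G ∈ flatsQ M 8 →
    TwoHyp M G 8 → mTr M G = 0 → ∀ t, 3 ≤ t → t ≤ 7 → 8 + t ≤ G.card → G.card < eightLargeBound t →
      0 ≤ Jq M G 8 t

/-- **`HighLayersCoreFree 8` from its certificate residue**: coranks `≤ t − 1` are demand-free
(`Jq_nonneg_of_card_le`), `|G| ≥ eightLargeBound t` is THEOREM LARGE₈ on `|G| ≤ 175` (`card_le_fCore_of_core`),
the rest is the residue. -/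
theorem highLayersCoreFree_eight_of_residue (h : HighLayersEightResidue) : HighLayersCoreFree 8 := by
  intro β _ M _ G hc hG hF hm t ht3 ht
  have h10 := core_flat_four_le_ten M hc
  have hG' := mem_flatsQ.1 hG
  by_cases hsmall : G.card + 1 ≤ 8 + t
  · exact Jq_nonneg_of_card_le (by omega) hsmall
  · by_cases hres : G.card < eightLargeBound t
    · exact h M G hc hG hF hm t ht3 (by omega) (by omega) hres
    · have h175 : G.card ≤ 175 := card_le_fCore_of_core hc h10 8 G hG
      exact jq_nonneg_of_large_eight hc h10 hG'.1 hG'.2.2 ht3 (by omega) (by omega) h175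

/-- **THE `(10, 8)` ROW OF C-025 FROM ITS TWO RESIDUES**: `HighLayersEightResidue` (the `267` certificate cases) and
`TraceSumsCore 7` (the level-`8` trace sums on the rank-`7` subsets of the core) — everything else is in the tree. -/
theorem rls_ten_eight_of_residues {γ : Type} [DecidableEq γ] (hres : HighLayersEightResidue)
    (htr7 : TraceSumsCore 7) (M : Matroid γ) [M.Finite] : RLS M 10 8 := by
  refine rls_succ_succ_of_highLayers 8 (by norm_num) (by norm_num) ?_ ?_ M
  · intro q' h4 h8
    have hq : q' = 4 ∨ q' = 5 ∨ q' = 6 ∨ q' = 7 := by omega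
    rcases hq with rfl | rfl | rfl | rfl
    · intro β _ M _ H hc hH hrH t ht
      exact traceSumsCore_four_of_ten (fun {β} [DecidableEq β] (M : Matroid β) [M.Finite] {p : ℕ} (hc : Core M p) =>
        core_flat_four_le_ten M hc) M H hc hH hrH t ht
    · intro β _ M _ H hc hH hrH t ht
      exact traceSumsCore_five_of_ten (fun {β} [DecidableEq β] (M : Matroid β) [M.Finite] {p : ℕ} (hc : Core M p) =>
        core_flat_four_le_ten M hc) M H hc hH hrH t ht
    · intro β _ M _ H hc hH hrH t ht
      exact traceSumsCore_six M H hc hH hrH t ht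
    · intro β _ M _ H hc hH hrH t ht
      exact htr7 M H hc hH hrH t ht
  · intro q' h5 h8
    have hq : q' = 5 ∨ q' = 6 ∨ q' = 7 ∨ q' = 8 := by omega
    rcases hq with rfl | rfl | rfl | rfl
    · intro β _ M _ G hc hG h2 hm t ht3 ht
      exact highLayersCoreFree_five_of_ten (fun {β} [DecidableEq β] (M : Matroid β) [M.Finite] {p : ℕ} (hc : Core M p) =>
        core_flat_four_le_ten M hc) M G hc hG h2 hm t ht3 ht
    · intro β _ M _ G hc hG h2 hm t ht3 ht
      exact highLayersCoreFree_six_of_ten (fun {β} [DecidableEq β] (M : Matroid β) [M.Finite] {p : ℕ} (hc : Core M p) =>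
        core_flat_four_le_ten M hc) M G hc hG h2 hm t ht3 ht
    · intro β _ M _ G hc hG h2 hm t ht3 ht
      exact highLayersCoreFree_seven M G hc hG h2 hm t ht3 ht
    · intro β _ M _ G hc hG h2 hm t ht3 ht
      exact highLayersCoreFree_eight_of_residue hres M G hc hG h2 hm t ht3 ht

/-- **THE `(10, 8)` ROW OF C-025 FROM TWO FINITE CERTIFICATE RESIDUES**: `HighLayersEightResidue` (`267` cases) and
`TraceSevenResidue` (`217` cases) — everything else is a tree theorem. -/
theorem rls_ten_eight_of_finite_residues {γ : Type} [DecidableEq γ] (hres : HighLayersEightResidue)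
    (htr : TraceSevenResidue) (M : Matroid γ) [M.Finite] : RLS M 10 8 :=
  rls_ten_eight_of_residues hres (traceSumsCore_seven_of_residue htr) M

end PercRepro.Night4
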